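import Mathlib
import HarnessLib
import Summits.Ventures.LatticeQCDFlow.Exactness.SU2A0Stein

/-!
# Moments of the `a₀` law of the SU(2) link weight: the Stein identity with local bounds and the moment recursion

HONEST FRAMING: exact (Metropolis-corrected) sampling algorithms for lattice gauge theory;
figures of merit are autocorrelation/cost numbers at stated couplings and volumes; no
continuum-physics claim.

Venture `LatticeQCDFlow` (cell pub-lqcd), topic `Exactness`, FANOUT row 9 (eng-latcore; the SU(2)
heat bath of `csrc/latcore_template.c` samples `a₀ = Re tr U / 2` from the law `∝ √(1 − a₀²) e^{βk a₀}`;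
acceptance test A3).  NEW WORK of the cell, continuing `SU2A0Stein.lean`:

* `su2_generator_stein_local`, **`su2_a0_stein_local`** — the identities of `SU2A0Stein.lean` with the
  bounds on `ψ, ψ′` required on `[-1, 1]` only (where `a₀` lives: `abs_su2a0_le_one`), so that
  polynomial test functions are admissible;
* `su2Moment c k = ∫ a₀^k e^{c a₀} dHaar_SU(2)` and **`su2Moment_rec`** — the three-term recursion
  `(k + 3) M_{k+1} + c M_{k+2} = k M_{k−1} + c M_k` (`ψ = t^k`), which at `c = 0` determines every
  Haar moment of `a₀`: **`su2Moment_zero_rec`** `(k + 3) M_{k+1} = k M_{k−1}`, `su2Moment_zero_zero = 1`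
  (so `M₂ = 1/4`, `M₄ = 1/8`, odd moments vanish — the moments of `(2/π)√(1 − t²) dt`, see
  `SU2A0Marginal.lean`).

Nothing is cited as a fact.
-/

namespace Summit.Ventures.LatticeQCDFlow.Exactness

open Matrix NormedSpace MeasureTheory Metric
open scoped Topology

/-! ## §1 `|a₀| ≤ 1` -/

/-- `∑_{i,j} ‖1_{ij}‖ = 2` for the `2 × 2` identity matrix. -/
theorem sum_norm_one_fin_two :
    ∑ i : Fin 2, ∑ j : Fin 2, ‖(1 : Matrix (Fin 2) (Fin 2) ℂ) i j‖ = 2 := by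
  simp [Fin.sum_univ_two, Matrix.one_apply]
  norm_num

/-- `|Re tr V| ≤ 2` for `V ∈ U(2)`. -/
theorem abs_re_trace_le_two {V : Matrix (Fin 2) (Fin 2) ℂ} (hV : V ∈ Matrix.unitaryGroup (Fin 2) ℂ) :
    |(V.trace).re| ≤ 2 := by
  have := abs_re_trace_mul_le_of_mem_unitaryGroup hV 1
  rwa [Matrix.mul_one, sum_norm_one_fin_two] at this

/-- `|a₀(U)| ≤ 1` on SU(2). -/
theorem abs_su2a0_le_one (U : Matrix.specialUnitaryGroup (Fin 2) ℂ) : |su2a0 U| ≤ 1 := by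
  rw [su2a0, abs_div, abs_two]
  have := abs_re_trace_le_two (Matrix.specialUnitaryGroup_le_unitaryGroup U.2)
  linarith

/-! ## §2 The Stein identities with bounds on `[-1, 1]` only -/

/-- **One-generator identity, local bounds** (cf. `su2_generator_stein`): the bounds on `ψ, ψ′` are
required for `|x| ≤ 1` only. -/
theorem su2_generator_stein_local (Z : Matrix (Fin 2) (Fin 2) ℂ) (hZ : Zᴴ = -Z) (hZ0 : Z.trace = 0)
    (hZZ : Z * Z = -1) (c : ℝ) {ψ ψ' : ℝ → ℝ} (hψ : ∀ x, HasDerivAt ψ (ψ' x) x)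
    (hψ'c : Continuous ψ') {K : ℝ} (hK : ∀ x, |x| ≤ 1 → |ψ x| ≤ K)
    (hK' : ∀ x, |x| ≤ 1 → |ψ' x| ≤ K) :
    ∫ U, (su2a0 U * ψ (su2a0 U) - su2x Z U ^ 2 * ψ' (su2a0 U) - c * su2x Z U ^ 2 * ψ (su2a0 U))
        * Real.exp (c * su2a0 U)
      ∂(Literature.MathematicalPhysics.QuantumFieldTheory.haarProbability
        (Matrix.specialUnitaryGroup (Fin 2) ℂ)) = 0 := by
  set μ := Literature.MathematicalPhysics.QuantumFieldTheory.haarProbability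
    (Matrix.specialUnitaryGroup (Fin 2) ℂ)
  have hψc : Continuous ψ := continuous_iff_continuousAt.mpr fun x => (hψ x).continuousAt
  have hK0 : 0 ≤ K := le_trans (abs_nonneg _) (hK 0 (by rw [abs_zero]; exact zero_le_one))
  -- the curve
  have hγU : ∀ (t : ℝ) (U : Matrix.specialUnitaryGroup (Fin 2) ℂ),
      (↑(expCurveSU Z hZ hZ0 t * U) : Matrix (Fin 2) (Fin 2) ℂ)
        = exp (t • Z) * (U : Matrix (Fin 2) (Fin 2) ℂ) :=
    fun t U => by rw [Submonoid.coe_mul, coe_expCurveSU]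
  have hcommZ : ∀ t : ℝ, exp (t • Z) * Z = Z * exp (t • Z) := fun t =>
    (((Commute.refl Z).smul_right t).exp_right).eq.symm
  have hZexp : ∀ (t : ℝ) (M : Matrix (Fin 2) (Fin 2) ℂ),
      Z * exp (t • Z) * M = exp (t • Z) * (Z * M) := fun t M => by
    rw [← hcommZ t, Matrix.mul_assoc]
  have hZZU : ∀ (M : Matrix (Fin 2) (Fin 2) ℂ), Z * (Z * M) = -M := fun M => by
    rw [← Matrix.mul_assoc, hZZ, Matrix.neg_mul, Matrix.one_mul]
  -- unitary bounds
  have hVU : ∀ (t : ℝ) (U : Matrix.specialUnitaryGroup (Fin 2) ℂ),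
      exp (t • Z) * (U : Matrix (Fin 2) (Fin 2) ℂ) ∈ Matrix.unitaryGroup (Fin 2) ℂ := fun t U => by
    rw [← hγU]; exact Matrix.specialUnitaryGroup_le_unitaryGroup (expCurveSU Z hZ hZ0 t * U).2
  set βZ : ℝ := ∑ i : Fin 2, ∑ j : Fin 2, ‖Z i j‖ with hβZ
  set β1 : ℝ := ∑ i : Fin 2, ∑ j : Fin 2, ‖(1 : Matrix (Fin 2) (Fin 2) ℂ) i j‖ with hβ1
  have hβZ0 : 0 ≤ βZ := by positivity
  have hβ10 : 0 ≤ β1 := by positivity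
  have bA : ∀ (t : ℝ) (U : Matrix.specialUnitaryGroup (Fin 2) ℂ),
      |((exp (t • Z) * (U : Matrix (Fin 2) (Fin 2) ℂ)).trace).re| ≤ β1 := fun t U => by
    have := abs_re_trace_mul_le_of_mem_unitaryGroup (hVU t U) 1
    rwa [Matrix.mul_one] at this
  have hβ1v : β1 = 2 := by rw [hβ1]; exact sum_norm_one_fin_two
  have hA1 : ∀ (t : ℝ) (U : Matrix.specialUnitaryGroup (Fin 2) ℂ),
      |((exp (t • Z) * (U : Matrix (Fin 2) (Fin 2) ℂ)).trace).re / 2| ≤ 1 := fun t U => by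
    rw [abs_div, abs_two]
    have := bA t U
    rw [hβ1v] at this
    linarith
  have ha1 : ∀ U : Matrix.specialUnitaryGroup (Fin 2) ℂ, |su2a0 U| ≤ 1 := fun U => by
    have := hA1 0 U
    rwa [zero_smul, NormedSpace.exp_zero, Matrix.one_mul] at this
  have bX : ∀ (t : ℝ) (U : Matrix.specialUnitaryGroup (Fin 2) ℂ),
      |((exp (t • Z) * (Z * (U : Matrix (Fin 2) (Fin 2) ℂ))).trace).re| ≤ βZ := fun t U => by
    rw [← Matrix.mul_assoc, hcommZ t, Matrix.mul_assoc, Matrix.trace_mul_comm]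
    exact abs_re_trace_mul_le_of_mem_unitaryGroup (hVU t U) Z
  -- the constant
  set C : ℝ := (1 + |c|) * (K + 1) * (β1 + βZ + βZ * βZ + 1) with hC
  have hc0 : 0 ≤ |c| := abs_nonneg c
  have hX0 : 0 ≤ β1 + βZ + βZ * βZ + 1 := by positivity
  have hABC : ∀ a b d : ℝ, 0 ≤ a → a ≤ 1 + |c| → 0 ≤ b → b ≤ K + 1 → 0 ≤ d →
      d ≤ β1 + βZ + βZ * βZ + 1 → a * b * d ≤ C := by
    intro a b d ha ha' hb hb' hd hd'
    rw [hC]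
    exact mul_le_mul (mul_le_mul ha' hb' hb (by linarith)) hd' hd
      (mul_nonneg (by linarith) (by linarith))
  have hsq : 0 ≤ βZ * βZ := mul_self_nonneg βZ
  -- continuity helpers
  have ctr : ∀ M N : Matrix (Fin 2) (Fin 2) ℂ, Continuous fun U : Matrix.specialUnitaryGroup (Fin 2) ℂ =>
      ((M * (N * (U : Matrix (Fin 2) (Fin 2) ℂ))).trace).re := fun M N =>
    Complex.continuous_re.comp ((continuous_const.matrix_mul
      (continuous_const.matrix_mul continuous_subtype_val)).matrix_trace)
  have ctr1 : ∀ M : Matrix (Fin 2) (Fin 2) ℂ, Continuous fun U : Matrix.specialUnitaryGroup (Fin 2) ℂ =>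
      ((M * (U : Matrix (Fin 2) (Fin 2) ℂ)).trace).re := fun M =>
    Complex.continuous_re.comp ((continuous_const.matrix_mul continuous_subtype_val).matrix_trace)
  have ma0 : Continuous su2a0 := by
    unfold su2a0
    exact (Complex.continuous_re.comp (continuous_subtype_val.matrix_trace)).div_const _
  have mx : Continuous (su2x Z) := by
    unfold su2x
    exact ((ctr1 Z).neg).div_const _
  -- apply the Haar–Stein identity
  have key := gibbs_stein (μ := μ) (γ := expCurveSU Z hZ hZ0) (ε := 1) (C := C)
    (h := fun U => su2x Z U * ψ (su2a0 U))
    (S := fun U => -(c * su2a0 U))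
    (Dh := fun t U =>
      (-((Z * exp (t • Z) * (Z * (U : Matrix (Fin 2) (Fin 2) ℂ))).trace).re / 2)
        * ψ (((exp (t • Z) * (U : Matrix (Fin 2) (Fin 2) ℂ)).trace).re / 2)
      + (-((exp (t • Z) * (Z * (U : Matrix (Fin 2) (Fin 2) ℂ))).trace).re / 2)
        * (ψ' (((exp (t • Z) * (U : Matrix (Fin 2) (Fin 2) ℂ)).trace).re / 2)
          * (((Z * exp (t • Z) * (U : Matrix (Fin 2) (Fin 2) ℂ)).trace).re / 2)))
    (DS := fun t U => -(c * (((Z * exp (t • Z) * (U : Matrix (Fin 2) (Fin 2) ℂ)).trace).re / 2)))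
    one_pos (expCurveSU_zero hZ hZ0)
    (mx.mul (hψc.comp ma0)).measurable (ma0.measurable.const_mul c).neg ?_ ?_ ?_ ?_ ?_ ?_ ?_ ?_
  · -- conclusion
    have h0 : exp ((0 : ℝ) • Z) = 1 := by rw [zero_smul, NormedSpace.exp_zero]
    refine Eq.trans (integral_congr_ae (Filter.Eventually.of_forall fun U => ?_)) key
    simp only [h0, Matrix.mul_one, Matrix.one_mul, hZZU, Matrix.trace_neg, Complex.neg_re]
    simp only [su2a0, su2x]
    ring
  · -- measurability of Dh 0
    simp only [zero_smul, NormedSpace.exp_zero, Matrix.mul_one, Matrix.one_mul]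
    refine Continuous.measurable ?_
    refine Continuous.add (Continuous.mul (((ctr Z Z).neg).div_const 2) (hψc.comp' ma0))
      (Continuous.mul (((ctr1 Z).neg).div_const 2) (Continuous.mul (hψ'c.comp' ma0)
        ((ctr1 Z).div_const 2)))
  · -- measurability of DS 0
    simp only [zero_smul, NormedSpace.exp_zero, Matrix.mul_one]
    exact ((((ctr1 Z).div_const 2).const_mul c).neg).measurable
  · -- derivative of h along the curve
    intro U t _
    have hAd : HasDerivAt (fun x : ℝ => ((exp (x • Z) * (U : Matrix (Fin 2) (Fin 2) ℂ)).trace).re / 2)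
        ((((Z * exp (t • Z) * (U : Matrix (Fin 2) (Fin 2) ℂ)).trace).re) / 2) t :=
      (hasDerivAt_re_trace_exp_smul_mul Z (U : Matrix (Fin 2) (Fin 2) ℂ) t).div_const 2
    have hXd : HasDerivAt (fun x : ℝ => -((exp (x • Z) * (Z * (U : Matrix (Fin 2) (Fin 2) ℂ))).trace).re / 2)
        (-(((Z * exp (t • Z) * (Z * (U : Matrix (Fin 2) (Fin 2) ℂ))).trace).re) / 2) t :=
      ((hasDerivAt_re_trace_exp_smul_mul Z (Z * (U : Matrix (Fin 2) (Fin 2) ℂ)) t).neg).div_const 2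
    have hcomp := hXd.mul ((hψ _).comp t hAd)
    refine hcomp.congr_of_eventuallyEq (Filter.Eventually.of_forall fun x => ?_)
    show su2x Z (expCurveSU Z hZ hZ0 x * U) * ψ (su2a0 (expCurveSU Z hZ hZ0 x * U)) = _
    rw [su2x, su2a0, hγU, ← Matrix.mul_assoc, hZexp]
    rfl
  · -- derivative of S along the curve
    intro U t _
    have hAd : HasDerivAt (fun x : ℝ => ((exp (x • Z) * (U : Matrix (Fin 2) (Fin 2) ℂ)).trace).re / 2)
        ((((Z * exp (t • Z) * (U : Matrix (Fin 2) (Fin 2) ℂ)).trace).re) / 2) t :=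
      (hasDerivAt_re_trace_exp_smul_mul Z (U : Matrix (Fin 2) (Fin 2) ℂ) t).div_const 2
    refine ((hAd.const_mul c).neg).congr_of_eventuallyEq (Filter.Eventually.of_forall fun x => ?_)
    show -(c * su2a0 (expCurveSU Z hZ hZ0 x * U)) = _
    rw [su2a0, hγU]
    rfl
  · -- |h U| ≤ C
    intro U
    have hx : |su2x Z U| ≤ βZ / 2 := by
      rw [su2x, abs_div, abs_neg, abs_two]
      have := abs_re_trace_mul_le_of_mem_unitaryGroup (hVU 0 U) Z
      rw [zero_smul, NormedSpace.exp_zero, Matrix.one_mul, ← Matrix.trace_mul_comm] at this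
      linarith
    rw [abs_mul]
    calc |su2x Z U| * |ψ (su2a0 U)| ≤ (βZ / 2) * K :=
          mul_le_mul hx (hK _ (ha1 U)) (abs_nonneg _) (by linarith)
      _ = 1 * K * (βZ / 2) := by ring
      _ ≤ C := hABC 1 K (βZ / 2) zero_le_one (by linarith) hK0 (by linarith) (by linarith)
          (by linarith)
  · -- |S U| ≤ C
    intro U
    have ha : |su2a0 U| ≤ β1 / 2 := by
      rw [su2a0, abs_div, abs_two]
      have := bA 0 U
      rw [zero_smul, NormedSpace.exp_zero, Matrix.one_mul] at this
      linarith
    rw [abs_neg, abs_mul]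
    calc |c| * |su2a0 U| ≤ |c| * (β1 / 2) := mul_le_mul_of_nonneg_left ha hc0
      _ = |c| * 1 * (β1 / 2) := by ring
      _ ≤ C := hABC |c| 1 (β1 / 2) hc0 (by linarith) zero_le_one (by linarith) (by linarith)
          (by linarith)
  · -- |Dh t U| ≤ C
    intro U t _
    have h1 : |(-((Z * exp (t • Z) * (Z * (U : Matrix (Fin 2) (Fin 2) ℂ))).trace).re / 2)| ≤ β1 / 2 := by
      rw [hZexp, hZZU, Matrix.mul_neg, Matrix.trace_neg, Complex.neg_re, neg_neg, abs_div, abs_two]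
      linarith [bA t U]
    have h2 : |(-((exp (t • Z) * (Z * (U : Matrix (Fin 2) (Fin 2) ℂ))).trace).re / 2)| ≤ βZ / 2 := by
      rw [abs_div, abs_neg, abs_two]; linarith [bX t U]
    have h3 : |(((Z * exp (t • Z) * (U : Matrix (Fin 2) (Fin 2) ℂ)).trace).re / 2)| ≤ βZ / 2 := by
      rw [hZexp, abs_div, abs_two]; linarith [bX t U]
    calc _ ≤ |(-((Z * exp (t • Z) * (Z * (U : Matrix (Fin 2) (Fin 2) ℂ))).trace).re / 2)
              * ψ (((exp (t • Z) * (U : Matrix (Fin 2) (Fin 2) ℂ)).trace).re / 2)|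
            + |(-((exp (t • Z) * (Z * (U : Matrix (Fin 2) (Fin 2) ℂ))).trace).re / 2)
              * (ψ' (((exp (t • Z) * (U : Matrix (Fin 2) (Fin 2) ℂ)).trace).re / 2)
                * (((Z * exp (t • Z) * (U : Matrix (Fin 2) (Fin 2) ℂ)).trace).re / 2))| := abs_add_le _ _
      _ ≤ (β1 / 2) * K + (βZ / 2) * (K * (βZ / 2)) := by
            rw [abs_mul, abs_mul, abs_mul]
            exact add_le_add (mul_le_mul h1 (hK _ (hA1 t U)) (abs_nonneg _) (by linarith))
              (mul_le_mul h2 (mul_le_mul (hK' _ (hA1 t U)) h3 (abs_nonneg _) hK0) (by positivity)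
                (by linarith))
      _ = 1 * K * (β1 / 2 + βZ * βZ / 4) := by ring
      _ ≤ C := hABC 1 K _ zero_le_one (by linarith) hK0 (by linarith) (by positivity) (by linarith)
  · -- |DS t U| ≤ C
    intro U t _
    have h3 : |(((Z * exp (t • Z) * (U : Matrix (Fin 2) (Fin 2) ℂ)).trace).re / 2)| ≤ βZ / 2 := by
      rw [hZexp, abs_div, abs_two]; linarith [bX t U]
    rw [abs_neg, abs_mul]
    calc |c| * _ ≤ |c| * (βZ / 2) := mul_le_mul_of_nonneg_left h3 hc0
      _ = |c| * 1 * (βZ / 2) := by ring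
      _ ≤ C := hABC |c| 1 (βZ / 2) hc0 (by linarith) zero_le_one (by linarith) (by linarith)
          (by linarith)

/-- **The `a₀` Stein identity of the SU(2) link law, local form.**  For every real `c` (`= βk`) and
every `C¹` test function `ψ` (continuous derivative), bounded together with `ψ′` on `[-1, 1]` only:
`∫ [ (1 − a₀²)(ψ′(a₀) + c ψ(a₀)) − 3 a₀ ψ(a₀) ] e^{c a₀} dHaar_SU(2)(U) = 0`. -/
theorem su2_a0_stein_local (c : ℝ) {ψ ψ' : ℝ → ℝ} (hψ : ∀ x, HasDerivAt ψ (ψ' x) x)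
    (hψ'c : Continuous ψ') {K : ℝ} (hK : ∀ x, |x| ≤ 1 → |ψ x| ≤ K)
    (hK' : ∀ x, |x| ≤ 1 → |ψ' x| ≤ K) :
    ∫ U, ((1 - su2a0 U ^ 2) * (ψ' (su2a0 U) + c * ψ (su2a0 U)) - 3 * su2a0 U * ψ (su2a0 U))
        * Real.exp (c * su2a0 U)
      ∂(Literature.MathematicalPhysics.QuantumFieldTheory.haarProbability
        (Matrix.specialUnitaryGroup (Fin 2) ℂ)) = 0 := by
  set μ := Literature.MathematicalPhysics.QuantumFieldTheory.haarProbability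
    (Matrix.specialUnitaryGroup (Fin 2) ℂ)
  have hψc : Continuous ψ := continuous_iff_continuousAt.mpr fun x => (hψ x).continuousAt
  have h1 := su2_generator_stein_local genZ1 genZ1_props.1 genZ1_props.2.1 genZ1_props.2.2 c hψ hψ'c hK hK'
  have h2 := su2_generator_stein_local genZ2 genZ2_props.1 genZ2_props.2.1 genZ2_props.2.2 c hψ hψ'c hK hK'
  have h3 := su2_generator_stein_local genZ3 genZ3_props.1 genZ3_props.2.1 genZ3_props.2.2 c hψ hψ'c hK hK'
  -- integrability of each generator integrand (continuous on a compact group)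
  have ma0 : Continuous su2a0 := by
    unfold su2a0
    exact (Complex.continuous_re.comp (continuous_subtype_val.matrix_trace)).div_const _
  have mx : ∀ Z : Matrix (Fin 2) (Fin 2) ℂ, Continuous (su2x Z) := fun Z => by
    unfold su2x
    exact ((Complex.continuous_re.comp ((continuous_const.matrix_mul
      continuous_subtype_val).matrix_trace)).neg).div_const _
  set T : Matrix (Fin 2) (Fin 2) ℂ → Matrix.specialUnitaryGroup (Fin 2) ℂ → ℝ := fun Z U =>
    (su2a0 U * ψ (su2a0 U) - su2x Z U ^ 2 * ψ' (su2a0 U) - c * su2x Z U ^ 2 * ψ (su2a0 U))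
      * Real.exp (c * su2a0 U) with hT
  have hint : ∀ Z : Matrix (Fin 2) (Fin 2) ℂ, Integrable (T Z) μ := fun Z =>
    integrable_of_continuous_SU2 ((((ma0.mul (hψc.comp ma0)).sub (((mx Z).pow 2).mul
      (hψ'c.comp ma0))).sub ((continuous_const.mul ((mx Z).pow 2)).mul (hψc.comp ma0))).mul
      (Real.continuous_exp.comp (continuous_const.mul ma0)))
  have h12 : Integrable (fun U => T genZ1 U + T genZ2 U) μ := (hint genZ1).add (hint genZ2)
  have hsum : ∫ U, (T genZ1 U + T genZ2 U + T genZ3 U) ∂μ = 0 := by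
    have e1 : ∫ U, (T genZ1 U + T genZ2 U + T genZ3 U) ∂μ
        = ∫ U, (T genZ1 U + T genZ2 U) ∂μ + ∫ U, T genZ3 U ∂μ := integral_add h12 (hint genZ3)
    have e2 : ∫ U, (T genZ1 U + T genZ2 U) ∂μ = ∫ U, T genZ1 U ∂μ + ∫ U, T genZ2 U ∂μ :=
      integral_add (hint genZ1) (hint genZ2)
    rw [e1, e2, h1, h2, h3, add_zero, add_zero]
  -- the target integrand is minus the sum (a₀² + Σ x_a² = 1)
  have hpt : ∀ U : Matrix.specialUnitaryGroup (Fin 2) ℂ,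
      ((1 - su2a0 U ^ 2) * (ψ' (su2a0 U) + c * ψ (su2a0 U)) - 3 * su2a0 U * ψ (su2a0 U))
        * Real.exp (c * su2a0 U) = -(T genZ1 U + T genZ2 U + T genZ3 U) := by
    intro U
    have hs := su2_sum_sq U
    have : 1 - su2a0 U ^ 2 = su2x genZ1 U ^ 2 + su2x genZ2 U ^ 2 + su2x genZ3 U ^ 2 := by linarith
    rw [this, hT]
    ring
  simp_rw [hpt, integral_neg, hsum, neg_zero]

/-! ## §3 The moments `M_k(c) = ∫ a₀^k e^{c a₀} dHaar` and their recursion -/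

/-- The `k`-th moment of `a₀` under the SU(2) link weight `e^{c a₀} dHaar_SU(2)` (unnormalised). -/
noncomputable def su2Moment (c : ℝ) (k : ℕ) : ℝ :=
  ∫ U, su2a0 U ^ k * Real.exp (c * su2a0 U)
    ∂(Literature.MathematicalPhysics.QuantumFieldTheory.haarProbability
      (Matrix.specialUnitaryGroup (Fin 2) ℂ))

/-- **Moment recursion** (`ψ = t^k` in `su2_a0_stein_local`): for every real `c` and every `k`,
`(k + 3) M_{k+1}(c) + c M_{k+2}(c) = k M_{k−1}(c) + c M_k(c)`. -/
theorem su2Moment_rec (c : ℝ) (k : ℕ) :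
    ((k : ℝ) + 3) * su2Moment c (k + 1) + c * su2Moment c (k + 2)
      = k * su2Moment c (k - 1) + c * su2Moment c k := by
  set μ := Literature.MathematicalPhysics.QuantumFieldTheory.haarProbability
    (Matrix.specialUnitaryGroup (Fin 2) ℂ)
  have h := su2_a0_stein_local c (ψ := fun x => x ^ k) (ψ' := fun x => (k : ℝ) * x ^ (k - 1))
    (K := (k : ℝ) + 1) (fun x => hasDerivAt_pow k x) (continuous_const.mul (continuous_pow _))
    (fun x hx => by
      rw [abs_pow]
      have := pow_le_one₀ (abs_nonneg x) hx (n := k)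
      have hk : (0 : ℝ) ≤ k := Nat.cast_nonneg k
      linarith)
    (fun x hx => by
      rw [abs_mul, abs_pow, Nat.abs_cast]
      have := pow_le_one₀ (abs_nonneg x) hx (n := k - 1)
      have hk : (0 : ℝ) ≤ k := Nat.cast_nonneg k
      nlinarith)
  have ma0 : Continuous su2a0 := by
    unfold su2a0
    exact (Complex.continuous_re.comp (continuous_subtype_val.matrix_trace)).div_const _
  have me : Continuous fun U : Matrix.specialUnitaryGroup (Fin 2) ℂ => Real.exp (c * su2a0 U) :=
    Real.continuous_exp.comp (continuous_const.mul ma0)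
  have hint : ∀ j : ℕ, Integrable (fun U => su2a0 U ^ j * Real.exp (c * su2a0 U)) μ := fun j =>
    integrable_of_continuous_SU2 ((ma0.pow j).mul me)
  -- pointwise form of the integrand
  have hk : ∀ a : ℝ, (k : ℝ) * (a ^ 2 * a ^ (k - 1)) = k * a ^ (k + 1) := by
    intro a
    cases k with
    | zero => simp
    | succ j => simp only [Nat.add_sub_cancel, pow_succ, Nat.cast_succ]; ring
  have hpt : ∀ U : Matrix.specialUnitaryGroup (Fin 2) ℂ,
      ((1 - su2a0 U ^ 2) * ((k : ℝ) * su2a0 U ^ (k - 1) + c * su2a0 U ^ k)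
          - 3 * su2a0 U * su2a0 U ^ k) * Real.exp (c * su2a0 U)
        = ((k : ℝ) * (su2a0 U ^ (k - 1) * Real.exp (c * su2a0 U))
            - ((k : ℝ) + 3) * (su2a0 U ^ (k + 1) * Real.exp (c * su2a0 U)))
          + (c * (su2a0 U ^ k * Real.exp (c * su2a0 U))
            - c * (su2a0 U ^ (k + 2) * Real.exp (c * su2a0 U))) := by
    intro U
    have h1 := hk (su2a0 U)
    calc _ = ((k : ℝ) * su2a0 U ^ (k - 1) - (k : ℝ) * (su2a0 U ^ 2 * su2a0 U ^ (k - 1))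
              + c * su2a0 U ^ k - c * su2a0 U ^ (k + 2) - 3 * su2a0 U ^ (k + 1))
              * Real.exp (c * su2a0 U) := by ring
      _ = ((k : ℝ) * su2a0 U ^ (k - 1) - (k : ℝ) * su2a0 U ^ (k + 1)
              + c * su2a0 U ^ k - c * su2a0 U ^ (k + 2) - 3 * su2a0 U ^ (k + 1))
              * Real.exp (c * su2a0 U) := by rw [h1]
      _ = _ := by ring
  simp_rw [hpt] at h
  have iF : ∀ (r : ℝ) (j : ℕ),
      Integrable (fun U => r * (su2a0 U ^ j * Real.exp (c * su2a0 U))) μ := fun r j =>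
    (hint j).const_mul r
  have iA : Integrable (fun U => (k : ℝ) * (su2a0 U ^ (k - 1) * Real.exp (c * su2a0 U))
      - ((k : ℝ) + 3) * (su2a0 U ^ (k + 1) * Real.exp (c * su2a0 U))) μ := (iF _ _).sub (iF _ _)
  have iB : Integrable (fun U => c * (su2a0 U ^ k * Real.exp (c * su2a0 U))
      - c * (su2a0 U ^ (k + 2) * Real.exp (c * su2a0 U))) μ := (iF _ _).sub (iF _ _)
  rw [integral_add iA iB, integral_sub (iF _ _) (iF _ _), integral_sub (iF _ _) (iF _ _),
    integral_const_mul, integral_const_mul, integral_const_mul, integral_const_mul] at h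
  simp only [su2Moment]
  linarith

/-- `M₀(0) = 1` (Haar is a probability measure). -/
theorem su2Moment_zero_zero : su2Moment 0 0 = 1 := by
  simp [su2Moment]

/-- **Haar moments of `a₀`**: `(k + 3) M_{k+1} = k M_{k−1}` at `c = 0`; with `M₀ = 1` this gives
`M₁ = 0, M₂ = 1/4, M₃ = 0, M₄ = 1/8, …`. -/
theorem su2Moment_zero_rec (k : ℕ) :
    ((k : ℝ) + 3) * su2Moment 0 (k + 1) = k * su2Moment 0 (k - 1) := by
  have h := su2Moment_rec 0 k
  simpa using h

/-- `⟨a₀⟩_Haar = 0`. -/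
theorem su2Moment_zero_one : su2Moment 0 1 = 0 := by
  have h := su2Moment_zero_rec 0
  norm_num at h
  exact h

/-- `⟨a₀²⟩_Haar = 1/4`. -/
theorem su2Moment_zero_two : su2Moment 0 2 = 1 / 4 := by
  have h := su2Moment_zero_rec 1
  rw [su2Moment_zero_zero] at h
  norm_num at h
  linarith

end Summit.Ventures.LatticeQCDFlow.Exactness
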